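import Mathlib
import Summits.CriticalPhenomena.Ising3DConformalLimit.Theses.PositivityBegetsConformality
import Summits.CriticalPhenomena.Ising3DConformalLimit.Theorems.PrecisionLaplacianMoebiusLimitOfTwoPointLawInversionBegetsRotations
import Literature.Probability.LatticeModels.ConformalCovariance
import Literature.Probability.LatticeModels.InversionPositivity
import HarnessLib

/-!
# Positivity begets conformality: `MoebiusOfInversionPositive`

(Item stmt-CriticalPhenomena-4673 of route `PositivityBegetsConformality`, the glue `(M)` of its
assembly.)

Let `S : CorrFamily 3` be normalised (`S = 0` off `NonCoincident`), translation invariant, scale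
covariant with weight `Δ` and **inversion positive** with weight `Δ` (the radial
Osterwalder–Schrader Gram matrices `M_{ab} = (∏ᵢ ‖X_b i‖^{-2Δ}) S (X_a ⊔ ιX_b)` over finite families
of injective configurations in the punctured open unit ball are positive semidefinite,
`Literature.Probability.LatticeModels.IsInversionPositive`). Then `S` is Möbius covariant with
weight `Δ`. The remaining hypotheses of the item (`S` is a pointwise scaling limit of the critical
Ising correlators under a positive renormalisation, non-degenerate two-point function) are not used.

Proof.
* **Positivity implies inversion covariance** (`isInversionCovariant_of_isInversionPositive`).
  A positive semidefinite real matrix is symmetric. For an injective configuration `x` in the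
  punctured open unit ball take the two-member family `{x (arity n), ∅ (arity 0)}`: the symmetry
  `M_{01} = M_{10}` of its Gram matrix reads `S n x = (∏ᵢ ‖xᵢ‖^{-2Δ}) · S n (ι ∘ x)`, i.e.
  `S n (ι ∘ x) = (∏ᵢ ‖xᵢ‖^{2Δ}) S n x` (`apply_inversion_of_ball`). A general configuration `x`
  avoiding the origin is first shrunk into the ball, `x = u⁻¹ • (u • x)` with
  `u = (1 + ∑ᵢ ‖xᵢ‖)⁻¹`, using scale covariance twice and `ι (u • y) = u⁻¹ • ι y`; non-injective
  configurations have both sides zero by the normalisation (`ι` is injective).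
* **Inversion begets rotations**: translation invariance and inversion covariance give invariance
  under all of `O(3)` — the landed theorem
  `PrecisionLaplacianMoebiusLimitOfTwoPointLaw.stub_inversionBegetsRotations` (item 4675 by name).
* Then `IsMoebiusCovariant Δ S = ⟨⟨translation, rotation⟩, scale, inversion⟩`.

References: G. Mack, *Osterwalder–Schrader positivity in conformal invariant quantum field theory*,
Lecture Notes in Physics 37 (1975) (radial OS positivity; here the elementary converse direction);
J. Glimm, A. Jaffe, *Quantum Physics* (2nd ed., Springer 1987), §6.1 (matrix form of OS
positivity); P. Di Francesco, P. Mathieu, D. Sénéchal, *Conformal Field Theory* (Springer 1997),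
§4.1. No definitions are introduced.
-/

noncomputable section

open Literature.Probability.LatticeModels EuclideanGeometry
open Summit.CriticalPhenomena.Ising3DConformalLimit.PrecisionLaplacianMoebiusLimitOfTwoPointLaw
  (inversion_zero_one_eq_smul norm_inversion_zero_one stub_inversionBegetsRotations)

namespace Summit.CriticalPhenomena.Ising3DConformalLimit.PositivityBegetsConformalityMoebiusOfInversionPositive

variable {Δ : ℝ} {S : CorrFamily 3}

/-! ### Elementary facts about the unit inversion and relabelled configurations -/

/-- The unit inversion is homogeneous of degree `-1`: `ι (c • y) = c⁻¹ • ι y` (all `c`, `y`, with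
the junk conventions `ι 0 = 0`, `0⁻¹ = 0`). [folklore] -/
theorem inversion_smul (c : ℝ) (y : EuclideanSpace ℝ (Fin 3)) :
    inversion 0 1 (c • y) = c⁻¹ • inversion 0 1 y := by
  rw [inversion_zero_one_eq_smul, inversion_zero_one_eq_smul, norm_smul, smul_smul, smul_smul,
    Real.norm_eq_abs, mul_pow, sq_abs]
  rcases eq_or_ne c 0 with rfl | hc
  · simp
  rcases eq_or_ne y 0 with rfl | hy
  · simp
  have hy' : ‖y‖ ^ 2 ≠ 0 := pow_ne_zero _ (norm_ne_zero_iff.2 hy)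
  congr 1
  field_simp

/-- Relabelling a configuration along a cast `Fin n → Fin m` (`n = m`) does not change the value of
a correlation family. [folklore] -/
theorem apply_comp_cast (S : CorrFamily 3) {m n : ℕ} (h : n = m)
    (x : Fin m → EuclideanSpace ℝ (Fin 3)) : S n (x ∘ Fin.cast h) = S m x := by
  subst h
  rfl

/-! ### Positivity implies inversion covariance -/

/-- **Inversion covariance inside the ball.** If `S` is inversion positive with weight `Δ`, then for
every injective configuration `x` in the punctured open unit ball
`S n (ι ∘ x) = (∏ᵢ ‖xᵢ‖^{2Δ}) · S n x`: the symmetry of the `2 × 2` radial OS Gram matrix of the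
family `{x, ∅}` (arities `n` and `0`). (Mack 1975, converse direction; Glimm–Jaffe 1987 §6.1.)
[folklore] -/
theorem apply_inversion_of_ball (hIP : IsInversionPositive Δ S) {n : ℕ}
    (x : Fin n → EuclideanSpace ℝ (Fin 3)) (hx : ∀ i, x i ≠ 0 ∧ ‖x i‖ < 1)
    (hinj : Function.Injective x) :
    S n (fun i => inversion 0 1 (x i)) = (∏ i, ‖x i‖ ^ (2 * Δ)) * S n x := by
  -- the two-member family `{x, ∅}`
  have key := hIP.weight_mul_append_comm (m := 2) (k := ![n, 0])
    (X := fun a => Fin.cases (motive := fun a => Fin ((![n, 0] : Fin 2 → ℕ) a) →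
      EuclideanSpace ℝ (Fin 3)) x (fun _ _ => 0) a) ?_ ?_ 0 1
  rotate_left
  · refine Fin.forall_fin_two.2 ⟨fun i => hx i, fun i => ?_⟩
    exact i.elim0
  · refine Fin.forall_fin_two.2 ⟨hinj, fun i => ?_⟩
    exact i.elim0
  change (∏ i : Fin 0, ‖(0 : EuclideanSpace ℝ (Fin 3))‖ ^ (-(2 * Δ))) *
      S (n + 0) (Fin.append x (fun _ : Fin 0 => inversion 0 1 (0 : EuclideanSpace ℝ (Fin 3)))) =
    (∏ i : Fin n, ‖x i‖ ^ (-(2 * Δ))) *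
      S (0 + n) (Fin.append (fun _ : Fin 0 => (0 : EuclideanSpace ℝ (Fin 3)))
        (fun i => inversion 0 1 (x i))) at key
  rw [Fin.prod_univ_zero, one_mul, Fin.append_right_nil _ _ rfl, Fin.append_left_nil _ _ rfl,
    apply_comp_cast S, apply_comp_cast S] at key
  -- `key : S n x = (∏ ‖x i‖^{-2Δ}) * S n (ι ∘ x)`
  have hw : (∏ i, ‖x i‖ ^ (2 * Δ)) * ∏ i, ‖x i‖ ^ (-(2 * Δ)) = 1 := by
    rw [← Finset.prod_mul_distrib]
    refine Finset.prod_eq_one fun i _ => ?_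
    rw [Real.rpow_neg (norm_nonneg _), mul_inv_cancel₀]
    exact (Real.rpow_pos_of_pos (norm_pos_iff.2 (hx i).1) _).ne'
  calc S n (fun i => inversion 0 1 (x i))
      = ((∏ i, ‖x i‖ ^ (2 * Δ)) * ∏ i, ‖x i‖ ^ (-(2 * Δ))) *
          S n (fun i => inversion 0 1 (x i)) := by rw [hw, one_mul]
    _ = (∏ i, ‖x i‖ ^ (2 * Δ)) * S n x := by rw [key]; ring

/-- **Positivity implies inversion covariance.** A correlation family on `ℝ³` which vanishes off
the non-coincident configurations, is scale covariant with weight `Δ` and inversion positive with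
weight `Δ` is inversion covariant with weight `Δ`: shrink the configuration into the unit ball by a
dilation (scale covariance, `ι (u • y) = u⁻¹ • ι y`) and use `apply_inversion_of_ball`;
non-injective configurations give `0 = 0`. Permutation symmetry is not needed. (Mack 1975,
converse direction.) [folklore] -/
theorem isInversionCovariant_of_isInversionPositive
    (hnorm : ∀ n z, z ∉ NonCoincident 3 n → S n z = 0) (hsc : IsScaleCovariant Δ S)
    (hIP : IsInversionPositive Δ S) : IsInversionCovariant Δ S := by
  intro n x hx0
  by_cases hinj : Function.Injective x
  swap
  · have h1 : S n x = 0 := hnorm n x hinj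
    have h2 : S n (fun i => inversion 0 1 (x i)) = 0 :=
      hnorm n _ fun h => hinj (Function.Injective.of_comp (f := inversion 0 1) h)
    rw [h1, h2, mul_zero]
  -- shrink into the ball
  set u : ℝ := (1 + ∑ i, ‖x i‖)⁻¹ with hu_def
  have hs : 0 < 1 + ∑ i, ‖x i‖ := by positivity
  have hu : 0 < u := inv_pos.2 hs
  have hball : ∀ i, u • x i ≠ 0 ∧ ‖u • x i‖ < 1 := by
    intro i
    refine ⟨smul_ne_zero hu.ne' (hx0 i), ?_⟩
    rw [norm_smul, Real.norm_eq_abs, abs_of_pos hu, hu_def, inv_mul_lt_iff₀ hs, mul_one]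
    have : ‖x i‖ ≤ ∑ j, ‖x j‖ :=
      Finset.single_le_sum (f := fun j => ‖x j‖) (fun j _ => norm_nonneg _) (Finset.mem_univ i)
    linarith
  have hinj' : Function.Injective fun i => u • x i :=
    fun i j h => hinj (smul_right_injective _ hu.ne' h)
  have hA := apply_inversion_of_ball hIP (fun i => u • x i) hball hinj'
  simp only [inversion_smul] at hA
  rw [hsc n u⁻¹ (inv_pos.2 hu), hsc n u hu] at hA
  -- `hA : u⁻¹^(-nΔ) S(ιx) = (∏ ‖u • x i‖^(2Δ)) * (u^(-nΔ) S x)`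
  have hprod : ∏ i, ‖u • x i‖ ^ (2 * Δ) = (u ^ (2 * Δ)) ^ n * ∏ i, ‖x i‖ ^ (2 * Δ) := by
    simp_rw [norm_smul, Real.norm_eq_abs, abs_of_pos hu,
      Real.mul_rpow hu.le (norm_nonneg _)]
    rw [Finset.prod_mul_distrib, Fin.prod_const]
  rw [hprod, Real.inv_rpow hu.le] at hA
  -- `hA : (u^(-nΔ))⁻¹ S(ιx) = ((u^(2Δ))^n * ∏ ‖x i‖^(2Δ)) * (u^(-nΔ) S x)`
  have ht : (0 : ℝ) < u ^ (-(n : ℝ) * Δ) := Real.rpow_pos_of_pos hu _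
  have h1 : (u ^ (2 * Δ)) ^ n * u ^ (-(n : ℝ) * Δ) * u ^ (-(n : ℝ) * Δ) = 1 := by
    rw [← Real.rpow_natCast, ← Real.rpow_mul hu.le, ← Real.rpow_add hu, ← Real.rpow_add hu]
    have e : 2 * Δ * (n : ℝ) + -(n : ℝ) * Δ + -(n : ℝ) * Δ = 0 := by ring
    rw [e, Real.rpow_zero]
  calc S n (fun i => inversion 0 1 (x i))
      = u ^ (-(n : ℝ) * Δ) *
          ((u ^ (-(n : ℝ) * Δ))⁻¹ * S n (fun i => inversion 0 1 (x i))) := by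
        rw [← mul_assoc, mul_inv_cancel₀ ht.ne', one_mul]
    _ = u ^ (-(n : ℝ) * Δ) *
          (((u ^ (2 * Δ)) ^ n * ∏ i, ‖x i‖ ^ (2 * Δ)) * (u ^ (-(n : ℝ) * Δ) * S n x)) := by
        rw [hA]
    _ = ((u ^ (2 * Δ)) ^ n * u ^ (-(n : ℝ) * Δ) * u ^ (-(n : ℝ) * Δ)) *
          ((∏ i, ‖x i‖ ^ (2 * Δ)) * S n x) := by ring
    _ = (∏ i, ‖x i‖ ^ (2 * Δ)) * S n x := by rw [h1, one_mul]

/-! ### The item -/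

/-- **`MoebiusOfInversionPositive`** (item stmt-CriticalPhenomena-4673, route
`PositivityBegetsConformality`): a normalised, translation invariant, scale covariant (weight `Δ`)
and inversion positive (weight `Δ`) family `S : CorrFamily 3` — in particular every such pointwise
scaling limit of the critical Ising correlators on `ℤ³` — is Möbius covariant with weight `Δ`:
inversion covariance is the symmetry half of inversion positivity
(`isInversionCovariant_of_isInversionPositive`), rotation invariance follows from translations and
the inversion (`stub_inversionBegetsRotations`), and
`IsMoebiusCovariant = ⟨⟨translation, rotation⟩, scale, inversion⟩`. The scaling-limit,
renormalisation and non-degeneracy hypotheses are idle. (Mack 1975; Di Francesco–Mathieu–Sénéchal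
1997 §4.1.) [folklore] -/
theorem moebiusOfInversionPositive_proof :
    Summit.CriticalPhenomena.Ising3DConformalLimit.Theses.PositivityBegetsConformality.MoebiusOfInversionPositive := by
  intro ρ Δ S _hρ _hlim hnorm _hnd htr hsc hIP
  have hIP' : IsInversionPositive Δ S := hIP
  have hinv : IsInversionCovariant Δ S := isInversionCovariant_of_isInversionPositive hnorm hsc hIP'
  have hrot : IsRotationInvariant S := stub_inversionBegetsRotations Δ S htr hinv
  exact ⟨⟨htr, hrot⟩, hsc, hinv⟩

end Summit.CriticalPhenomena.Ising3DConformalLimit.PositivityBegetsConformalityMoebiusOfInversionPositive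

end
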